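import Summits.QuantumFields.YangMills.Theorems.BalabanUVNodesK0AxMomentSocketPvol
import Literature.Analysis.Calculus.ContDiffUniformLimit

/-!
# BalabanUVNodes ∕ K0ᴬ–K1ᴬ — LENS P3 §8: THE TIGHT ∕ LOCAL FINITE-VOLUME DOOR (the weakest finite-volume supply of the junction socket typed on the moment road:
# one-sided TIGHTNESS for the floor (iv), LOCAL uniform Cauchy-ness for the continuity row (C))

LANDING (porter PTC-1 g3, 2026-08-31): landed VERBATIM from the ideation cell's HOME sketch `nodeO-cover/P3-K1AxSocketTight-v1.1.lean` (sha16 fdd5a205765c5b07, 285 l.,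
author seat ★ P3 gen 89, OFFER №6 v1.1 — the third socket column after ✓`…K0AxMomentSocketRows` ∕ ✓`…K0AxMomentSocketPvol`) as a K0ᴬ helper `--supports stmt-QuantumFields-27238
--as helper` under the basename the author named (`…K0AxMomentSocketTight`); only this paragraph was added.  CONDITIONAL helpers + folklore analysis lemmas: the `def … : Prop`
below are HYPOTHESIS SHAPES (open, Bałaban-strength), every theorem takes them as hypotheses; nothing of [B12]∕[B13] is asserted, ported, discharged or refuted; K0ᴬ (stmt-27238) stays OPEN.

IDEATION CELL `ym-nodeO-ideate`, author seat ★ P3 («weaken the target»), gen 89 — a typed SKETCH offered to the porters (count-neutral seat; nothing here is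
filed by the author).  Eighth module of the moment road; imports §7 (✓p816986 `…K0AxMomentSocketPvol`) and the tree's folklore `Literature.Analysis.Calculus.uniformCauchySeqOn_of_le_geometric`
(`ContDiffUniformLimit`).  Namespace `Summit.QuantumFields.YangMills.Theorems.K0AxMomentRoad`.  Edition v1.1 = v1 + §8e.

WHAT §7 LEFT.  §7 inherits §6's limit-kernel letters from finite volume with two sufficient-but-not-weakest uniformities: (V-ucauchy-box) asks the volume limit to be
uniform on the WHOLE box, and (V-negpart-box) bundles a window-UNIFORM summable MAJORANT with the sign floor.  LENS P3 asks for the weakest typed form of each: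
* §8a ★ `neg_le_tsum_of_window_lowerTight` — ONE-SIDED VITALI through an exhausting window: `f K z → g z` termwise with `g` summable, and for every `ε > 0` a finite `S`
  with, for cofinally many `K` at once, `Σ_{z ∈ W K ∖ S} (f K z)⁺ ≤ ε` («no positive mass escapes to infinity») and `−c ≤ Σ_{z ∈ W K} f K z` ⟹ `−c ≤ Σ'_z g z`.  No
  majorant (`le_of_forall_pos_le_add`, `Finset.sum_sdiff`, closedness of `[−c − ε∕2, ∞[` along the cofinal set, the `HasSum` tail); the tightness form of §7a's
  `tendsto_windowSum_of_dominated` for LOWER bounds — Fatou has the wrong sign here.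
* §8b LETTERS: (V-lucauchy-box) `RecordPvolLocUniformCauchyOnBoxAx` — at each box history a neighbourhood WITHIN the box on which the finite-volume entries are uniformly
  Cauchy in the volume (continuity is local; (V-ucauchy-box) ⟹ it with `t :=` the box); (V-lowtight-box e) `RecordPvolMomentLowerTightOnBoxAx` — `e ≥ 0` summable, an
  exhausting window per box history, and for every `ε > 0` a finite `S ⊂ ℤ⁴` with, cofinally in `K`, positive windowed-moment mass outside `S` `≤ ε` AND the signed window
  moment `≥ −e_k` ((V-negpart-box e) ⟹ it with `S` a tail set of its majorant `m_k`).
* §8c FEEDING: ★ (L-lim-box) + (V-cont-box) + (V-lucauchy-box) ⟹ (L-cont-box) (`UniformCauchySeqOn.tendstoUniformlyOn_of_tendsto` + `TendstoUniformlyOn.continuousOn` on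
  `t ∩ Box`, then `ContinuousWithinAt.mono_of_mem_nhdsWithin`); ★ (L-lim-box) + (L-absmom-box) + (V-lowtight-box e) ⟹ (L-negpart-box e) (§8a; the summability of the limit
  moment is read off (L-absmom-box), which the |β| rows need anyway and (V-absmom-box) pays by Fatou).
* §8d ★★★ `record13SepCoPHInhabitedAx_of_pvolBoxLettersTight_cofinalRadii` — K0ᴬ `Theses.BalabanUVNodes.Record13SepCoPHInhabitedAx` BY NAME from (L-lim-box) +
  (V-absmom-box) + (V-dom-ev-box) + (V-cont-box) + (V-lucauchy-box) + (V-lowtight-box) at cofinally small radii, through §6's ★★★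
  `record13SepCoPHInhabitedAx_of_plimBoxLetters_cofinalRadii` — §7's door with (V-ucauchy-box) ↦ (V-lucauchy-box) and (V-negpart-box) ↦ (V-dom-ev-box) ∧ (V-lowtight-box)
  (the pointwise-eventual domination now serves (C) only; the floor is served by tightness).
* §8e THE TWO-VOLUME LETTER AT THE JUNCTION — typed edge facts about lens-1's [E] `K0AxTwoVolumeRate.RecordPvolTwoVolExpOnRunsAx` (✓p814710; JOIN-T v2's output):
  (e1) it feeds (L-lim) ALONG RUNS by name, hence K0ᴬ's run doors; (e2) it does not reach the junction body `CofinalBetaSocketAxBody`, whose |β| half lives on the BOX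
  (`BetaLowerH ∕ BetaUpperH … Box γ₀ k`, all histories — the runs are the one-parameter family `x ↦ run(x)` inside it) and whose every box door consumes `PolLimitOnBoxOf`;
  (e3) its threshold `∃ K₀` is chosen AFTER the history, so it gives pointwise convergence, not the locally history-uniform Cauchy-ness (C) consumes; (e4) a two-volume
  DIFFERENCE letter never feeds |β| (absolute size) or (iv) (sign).  REPAIR, typed: (E-lu-box E₀ κ) `RecordPvolTwoVolExpLocUnifOnBoxAx` = [E] with exactly two quantifier
  edits (box histories; `∃ K₀` before `∀ w ∈ t`, `t` a relative box-neighbourhood), same constants and majorant; ★ (E-lu-box) ⟹ (V-lucauchy-box) (through the thresholded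
  corollary `uniformCauchySeqOn_of_eventually_le_geometric` of the tree's folklore lemma) and ★ (E-lu-box) ⟹ (L-lim-box) (lens-1's pointwise engine
  `K0AxJoinResidual.polLimitExists_of_twoVolume_geomRate` at `w := v`); ★★★ `record13SepCoPHInhabitedAx_of_twoVolExpBoxLettersTight_cofinalRadii` = §8d's door with
  (L-lim-box) ∧ (V-lucauchy-box) both read off (E-lu-box): K0ᴬ BY NAME from (E-lu-box) + (V-absmom-box) + (V-dom-ev-box) + (V-cont-box) + (V-lowtight-box e).

LENS-P3 PRICE TAGS, FINAL FORM AT THE JUNCTION (numbers, not adjectives): |β| box + row (i) ⟸ FATOU (cofinal bounds on |window sums|); (C) ⟸ LOCALLY UNIFORM LIMIT + the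
per-scale M-test; (iv) ⟸ ONE-SIDED TIGHTNESS of the positive windowed-moment mass along the cofinal volumes where the finite-volume floor holds — the one input no absolute
estimate supplies is the SIGN (`−e_k ≤` signed window moment, `Σ e < ∞`: the finite-volume face of asymptotic freedom, [I] Thm 2 (0.31) p.259, (5.44) p.297); K-uniform
windowed (5.10) with history-free constants pays every absolute ∕ domination ∕ tightness letter at once.  What it is NOT: none of the letters is proved, asserted, ported
or discharged here; they are OPEN Bałaban-strength content; K0ᴬ ∕ K1ᴬ ∕ K3ᴬ stay OPEN; NODE O 0∕1; finite 𝕋⁴ at fixed ε — not continuum ∕ OS ∕ Clay; the Yang–Mills mass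
gap is NOT proved by any of this.

JUNK CENSUS (CRIT-1 g36's J1′ test, pre-applied): all three `def … : Prop` below are junk-TRUE exactly at `γ ≤ 0` (`Box γ k = ∅`: vacuous `∀ v ∈ Box`, `e := 0`) and nowhere
else cheaply (`recordPvolAx` PINNED; `t ∈ 𝓝[Box γ k] v` is a genuine relative neighbourhood — the Ioc-cube has no isolated points — so uniform Cauchy-ness on `t` contains
at least the convergence of the pinned entry at `v`; `S` is ONE finite set against windows exhausting `ℤ⁴`, so the tail `W K ∖ S` is cofinally all of `ℤ⁴ ∖ S`; (E-lu-box) carries `0 < κ` and is FALSE, not vacuous, for `E₀ < 0 < γ` since `v ∈ t`); the doors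
quantify `0 < γ₀ ∧ γ₀ ≤ ½ ∧ 0 < ε₂₉`.
-/

open scoped BigOperators Matrix.Norms.L2Operator Topology
open Set Filter
open Summit.QuantumFields.YangMills.Theorems.K0RecordFormatNames
open Summit.QuantumFields.YangMills.Theorems
open Literature.MathematicalPhysics.QuantumFieldTheory.Balaban1983to89
open Literature.MathematicalPhysics.QuantumFieldTheory.Balaban1983to89.Node00
open Literature.MathematicalPhysics.QuantumFieldTheory.Balaban1983to89.T4Continuum (T4Family)
open Literature.MathematicalPhysics.QuantumFieldTheory.Balaban1983to89.FlowStep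

namespace Summit.QuantumFields.YangMills.Theorems.K0AxMomentRoad

variable (F : T4Family) (a₀ ε₂₉ : ℝ)

/-! ## §8a Generic: ONE-SIDED VITALI THROUGH AN EXHAUSTING WINDOW (lower bounds pass to the limit sum under tightness of the positive escaping mass — no majorant) -/

/-- **One-sided Vitali through an exhausting window** (the TIGHTNESS form of `…K0AxMomentSocketPvol`'s `tendsto_windowSum_of_dominated`, lower bounds only): if `f K z → g z` for every `z` with `g`
summable, the finite windows `W K` exhaust the index type, and for every `ε > 0` there is a finite `S` such that for COFINALLY many `K` at once (a) the POSITIVE mass of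
`f K` on the window outside `S` is `≤ ε` («no positive mass escapes to infinity») and (b) the window sum is `≥ −c`, then `−c ≤ Σ'_z g z`.  No majorant: the weakest
classical hypothesis under which a LOWER bound on window-truncated sums passes to the sum of the termwise limits (window-uniform domination by a summable `m` implies it,
with `S` a tail set of `m`; Fatou gives nothing here — the inequality has the wrong sign). [cite: Balaban1987RG1, (1.21)–(1.22) p.264 (analysis bookkeeping for the volume
limit of the signed β-moments)] -/
theorem neg_le_tsum_of_window_lowerTight {Z : Type*} [DecidableEq Z] {f : ℕ → Z → ℝ} {g : Z → ℝ} {W : ℕ → Finset Z} {c : ℝ}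
    (hg : Summable g) (hW : ∀ z, ∀ᶠ K in atTop, z ∈ W K) (hlim : ∀ z, Tendsto (fun K => f K z) atTop (𝓝 (g z)))
    (h : ∀ ε : ℝ, 0 < ε → ∃ S : Finset Z, ∃ᶠ K in atTop,
      (∑ z ∈ W K \ S, max (f K z) 0) ≤ ε ∧ -c ≤ ∑ z ∈ W K, f K z) :
    -c ≤ ∑' z, g z := by
  refine le_of_forall_pos_le_add fun ε hε => ?_
  obtain ⟨S, hS⟩ := h (ε / 2) (half_pos hε)
  have hsum : Tendsto (fun s : Finset Z => ∑ z ∈ s, g z) atTop (𝓝 (∑' z, g z)) := hg.hasSum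
  obtain ⟨S₂, hS₂⟩ := eventually_atTop.1 ((Metric.tendsto_nhds.1 hsum) (ε / 2) (half_pos hε))
  have hsub : ∀ᶠ K in atTop, S ∪ S₂ ⊆ W K :=
    ((eventually_all_finset (S ∪ S₂)).2 fun z _ => hW z).mono fun K hK z hz => hK z hz
  have hT : Tendsto (fun K => ∑ z ∈ S ∪ S₂, f K z) atTop (𝓝 (∑ z ∈ S ∪ S₂, g z)) :=
    tendsto_finsetSum _ fun z _ => hlim z
  have hfr : ∃ᶠ K in atTop, -c - ε / 2 ≤ ∑ z ∈ S ∪ S₂, f K z := by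
    refine (hS.and_eventually hsub).mono ?_
    rintro K ⟨⟨htail, hlow⟩, hK⟩
    have hsplit := Finset.sum_sdiff (f := fun z => f K z) hK
    have htail' : ∑ z ∈ W K \ (S ∪ S₂), f K z ≤ ε / 2 :=
      calc ∑ z ∈ W K \ (S ∪ S₂), f K z ≤ ∑ z ∈ W K \ (S ∪ S₂), max (f K z) 0 :=
            Finset.sum_le_sum fun z _ => le_max_left _ _
        _ ≤ ∑ z ∈ W K \ S, max (f K z) 0 :=
            Finset.sum_le_sum_of_subset_of_nonneg (Finset.sdiff_subset_sdiff le_rfl Finset.subset_union_left)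
              fun z _ _ => le_max_right _ _
        _ ≤ ε / 2 := htail
    linarith
  have hlimS : -c - ε / 2 ≤ ∑ z ∈ S ∪ S₂, g z := isClosed_Ici.mem_of_frequently_of_tendsto hfr hT
  have hd : dist (∑ z ∈ S ∪ S₂, g z) (∑' z, g z) < ε / 2 := hS₂ _ Finset.subset_union_right
  rw [Real.dist_eq] at hd
  have h2 := (abs_lt.1 hd).2
  linarith

/-! ## §8b The two weakest finite-volume letters: LOCAL uniform Cauchy-ness (for (C)) and ONE-SIDED TIGHTNESS with the sign floor (for (iv)) -/

/-- **(V-lucauchy-box) — RECEIPT «THE VOLUME LIMIT (1.21) IS LOCALLY UNIFORM IN THE BOX HISTORY»** (the LOCAL form of (V-ucauchy-box)): for each `k`, `z` and each box history `v`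
there is a neighbourhood `t` of `v` within the box on which the finite-volume entries `(K, w) ↦ Π^{T_K}_{k+1}(w; z)₀₁` are uniformly Cauchy in `K`.  Continuity being local,
this is the weakest volume-uniformity the (C) row consumes; `…K0AxMomentSocketPvol`'s box-uniform (V-ucauchy-box) ⟹ it with `t :=` the box (`self_mem_nhdsWithin`).  HYPOTHESIS SHAPE,
OPEN here. [cite: Balaban1987RG1, (1.21) p.264 («This limit exists by the localized representation (1.7)»)] -/
def RecordPvolLocUniformCauchyOnBoxAx (γ : ℝ) : Prop :=
  ∀ (k : ℕ) (z : Fin 4 → ℤ) (v : Fin (k + 1) → ℝ), v ∈ Box γ k → ∃ t ∈ 𝓝[Box γ k] v,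
    UniformCauchySeqOn (fun (K : ℕ) (w : Fin (k + 1) → ℝ) => recordPvolAx F a₀ ε₂₉ k w K 0 1 z) atTop t

/-- **(V-lowtight-box e) — RECEIPT «NO POSITIVE MOMENT MASS ESCAPES TO INFINITY ALONG COFINALLY MANY VOLUMES, WITH THE SIGN FLOOR»** (the TIGHTNESS form of (V-negpart-box):
its majorant removed): `e ≥ 0` summable; at every box history an exhausting window `W`; for every `ε > 0` a finite `S ⊂ ℤ⁴` such that for cofinally many volumes `K` AT ONCE the
positive part of the windowed (1.22)-moment outside `S` is `≤ ε` and the signed window moment is `≥ −e_k`.  The weakest typed finite-volume letter feeding the floor (iv)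
(given the summability of the limit moment, which the |β| rows' (V-absmom-box) supplies by Fatou); (V-negpart-box e) ⟹ it (take `S` a tail set of `m_k`).  HYPOTHESIS SHAPE
(finite-volume face of asymptotic freedom's sign); OPEN here. [cite: Balaban1987RG1, Thm 2 (0.31) p.259, (1.20)–(1.22) p.264, (5.44) p.297] -/
def RecordPvolMomentLowerTightOnBoxAx (γ : ℝ) (e : ℕ → ℝ) : Prop :=
  (∀ k, 0 ≤ e k) ∧ Summable e ∧ ∀ (k : ℕ) (v : Fin (k + 1) → ℝ), v ∈ Box γ k →
    ∃ W : ℕ → Finset (Fin 4 → ℤ), (∀ z : Fin 4 → ℤ, ∀ᶠ K in atTop, z ∈ W K) ∧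
      ∀ ε : ℝ, 0 < ε → ∃ S : Finset (Fin 4 → ℤ), ∃ᶠ K in atTop,
        (∑ z ∈ W K \ S, max (recordPvolAx F a₀ ε₂₉ k v K 0 1 z * (z 0 : ℝ) * (z 1 : ℝ)) 0) ≤ ε ∧
          -e k ≤ ∑ z ∈ W K, recordPvolAx F a₀ ε₂₉ k v K 0 1 z * (z 0 : ℝ) * (z 1 : ℝ)

/-! ## §8c Feeding §6's limit-kernel letters: (C) locally, (iv) tightly -/

/-- ★ **(L-lim-box) ∧ (V-cont-box) ∧ (V-lucauchy-box) ⟹ (L-cont-box)** (locally uniformly Cauchy + pointwise limit ⟹ locally uniform convergence ⟹ the limit entry is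
continuous in the history: `UniformCauchySeqOn.tendstoUniformlyOn_of_tendsto`, `TendstoUniformlyOn.continuousOn` on a neighbourhood within the box, then
`ContinuousWithinAt.mono_of_mem_nhdsWithin`).  The LOCAL refinement of `…K0AxMomentSocketPvol`'s `recordPlimContOnBoxAx_of_pvol` (box-uniform Cauchy): the
junction's CONTINUITY row (C) is inheritable from finite volume WITHOUT a rate and WITHOUT box-uniformity (rated ancestor: the β sub-cell's
`Beta.BetaContinuityVolume.continuousOn_lim_of_volumeRate`, (C-fin) + a history-uniform VOLUME RATE (VR-u)). [cite: Balaban1987RG1, (1.21)–(1.22) p.264] -/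
theorem recordPlimContOnBoxAx_of_pvol_loc {γ : ℝ}
    (hlim : letI θ := thetaFill F a₀ ε₂₉
      letI := θ.instVβ₁; letI := θ.instVβ₂; letI := θ.instιβ
      PolLimitOnBoxOf F (recordTermsAx F a₀ ε₂₉) θ.ρ8 θ.bV γ)
    (hc : RecordPvolContOnBoxAx F a₀ ε₂₉ γ) (hu : RecordPvolLocUniformCauchyOnBoxAx F a₀ ε₂₉ γ) : RecordPlimContOnBoxAx F a₀ ε₂₉ γ := by
  intro k z v hv
  letI θ := thetaFill F a₀ ε₂₉
  letI := θ.instVβ₁; letI := θ.instVβ₂; letI := θ.instιβ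
  obtain ⟨t, ht, hU⟩ := hu k z v hv
  have ht' : t ∩ Box γ k ∈ 𝓝[Box γ k] v := Filter.inter_mem ht self_mem_nhdsWithin
  have hT : TendstoUniformlyOn (fun (K : ℕ) (w : Fin (k + 1) → ℝ) => recordPvolAx F a₀ ε₂₉ k w K 0 1 z)
      (fun w => recordPlimAx F a₀ ε₂₉ k w 0 1 z) atTop (t ∩ Box γ k) :=
    (hU.mono Set.inter_subset_left).tendstoUniformlyOn_of_tendsto fun w hw =>
      tendsto_pvolOf F (recordTermsAx F a₀ ε₂₉) θ.ρ8 θ.bV k w (hlim k w hw.2) 0 1 z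
  have hcont : ContinuousOn (fun w : Fin (k + 1) → ℝ => recordPlimAx F a₀ ε₂₉ k w 0 1 z) (t ∩ Box γ k) :=
    hT.continuousOn ((hc k z).mono fun K hK => hK.mono Set.inter_subset_right)
  exact (hcont v ⟨mem_of_mem_nhdsWithin hv ht, hv⟩).mono_of_mem_nhdsWithin ht'

/-- ★ **(L-lim-box) ∧ (L-absmom-box) ∧ (V-lowtight-box e) ⟹ (L-negpart-box e)** — the TIGHT form of `…K0AxMomentSocketPvol`'s `recordPlimMomentNegPartOnBoxAx_of_pvol`: no majorant; the lower bound on the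
signed window moments passes to the (1.22)-moment of the limit kernel as soon as no positive moment mass escapes to infinity along the cofinal volumes where the floor holds
(`neg_le_tsum_of_window_lowerTight`; the summability of the limit moment is read off (L-absmom-box), which the |β| rows need anyway).  This is the weakest finite-volume
supply of the junction's FLOOR row (iv) typed here. [cite: Balaban1987RG1, Thm 2 (0.31) p.259, (1.21)–(1.22) p.264, (5.42)–(5.44) p.297] -/
theorem recordPlimMomentNegPartOnBoxAx_of_pvol_lowerTight {γ M : ℝ} {e : ℕ → ℝ}
    (hlim : letI θ := thetaFill F a₀ ε₂₉
      letI := θ.instVβ₁; letI := θ.instVβ₂; letI := θ.instιβ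
      PolLimitOnBoxOf F (recordTermsAx F a₀ ε₂₉) θ.ρ8 θ.bV γ)
    (habs : RecordPlimAbsMomentOnBoxAx F a₀ ε₂₉ γ M) (h : RecordPvolMomentLowerTightOnBoxAx F a₀ ε₂₉ γ e) :
    RecordPlimMomentNegPartOnBoxAx F a₀ ε₂₉ γ e := by
  refine ⟨h.1, h.2.1, fun k v hv => ?_⟩
  obtain ⟨W, hW, ht⟩ := h.2.2 k v hv
  letI θ := thetaFill F a₀ ε₂₉
  letI := θ.instVβ₁; letI := θ.instVβ₂; letI := θ.instιβ
  have hlimz : ∀ z : Fin 4 → ℤ, Tendsto (fun K => recordPvolAx F a₀ ε₂₉ k v K 0 1 z * (z 0 : ℝ) * (z 1 : ℝ)) atTop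
      (𝓝 (recordPlimAx F a₀ ε₂₉ k v 0 1 z * (z 0 : ℝ) * (z 1 : ℝ))) := fun z =>
    ((tendsto_pvolOf F (recordTermsAx F a₀ ε₂₉) θ.ρ8 θ.bV k v (hlim k v hv) 0 1 z).mul_const _).mul_const _
  have hg : Summable (fun z : Fin 4 → ℤ => recordPlimAx F a₀ ε₂₉ k v 0 1 z * (z 0 : ℝ) * (z 1 : ℝ)) :=
    summable_abs_iff.1 ((habs k v hv).1.congr fun z => by rw [abs_mul, abs_mul])
  exact neg_le_tsum_of_window_lowerTight hg hW hlimz ht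

/-! ## §8d ★★★ K0ᴬ by name — the TIGHT ∕ LOCAL finite-volume door -/

/-- ★★★ **K0ᴬ BY NAME FROM FINITE VOLUME — THE TIGHT ∕ LOCAL FORM** (LENS P3: the weakest finite-volume supply of the junction socket typed on the moment road): as
`…K0AxMomentSocketPvol`'s `record13SepCoPHInhabitedAx_of_pvolBoxLetters_cofinalRadii` with (V-ucauchy-box) weakened to the LOCAL (V-lucauchy-box), and (V-negpart-box) split into the pointwise-eventual
domination (V-dom-ev-box) (consumed by (C) only) and the one-sided tightness (V-lowtight-box e) (consumed by (iv); the summability it needs is the |β| rows' (V-absmom-box), by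
Fatou).  CONDITIONAL on the displayed supply — OPEN Bałaban-strength content; K0ᴬ stmt-QuantumFields-27238 OPEN; the Yang–Mills mass gap is NOT proved.
[cite: Balaban1987RG1, Thm 1 p.259, Thm 2 (0.31) p.259, Thm 3 p.264, (1.20)–(1.22) p.264, (4.37) p.291, (5.42)–(5.44) p.297] -/
theorem record13SepCoPHInhabitedAx_of_pvolBoxLettersTight_cofinalRadii
    (H : ∀ (F : T4Family) (a : ℝ), 0 < a → ∃ a₀ : ℝ, 0 < a₀ ∧ a₀ ≤ a ∧ ∃ (γ₀ ε₂₉ M : ℝ) (e : ℕ → ℝ), 0 < γ₀ ∧ γ₀ ≤ 1 / 2 ∧ 0 < ε₂₉ ∧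
      (letI θ := thetaFill F a₀ ε₂₉
       letI := θ.instVβ₁; letI := θ.instVβ₂; letI := θ.instιβ
       PolLimitOnBoxOf F (recordTermsAx F a₀ ε₂₉) θ.ρ8 θ.bV γ₀) ∧
      RecordPvolAbsMomentOnBoxAx F a₀ ε₂₉ γ₀ M ∧ RecordPvolMomentDominatedEvOnBoxAx F a₀ ε₂₉ γ₀ ∧ RecordPvolContOnBoxAx F a₀ ε₂₉ γ₀ ∧
        RecordPvolLocUniformCauchyOnBoxAx F a₀ ε₂₉ γ₀ ∧ RecordPvolMomentLowerTightOnBoxAx F a₀ ε₂₉ γ₀ e) :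
    Summit.QuantumFields.YangMills.Theses.BalabanUVNodes.Record13SepCoPHInhabitedAx :=
  record13SepCoPHInhabitedAx_of_plimBoxLetters_cofinalRadii fun F a ha => by
    obtain ⟨a₀, ha₀, hle, γ₀, ε₂₉, M, e, hγ₀, hγh, hε, hlim, hV, hdom, hc, hu, htight⟩ := H F a ha
    have habs := recordPlimAbsMomentOnBoxAx_of_pvol F a₀ ε₂₉ hlim hV
    exact ⟨a₀, ha₀, hle, γ₀, ε₂₉, M, e, hγ₀, hγh, hε, habs,
      recordPlimContOnBoxAx_of_pvol_loc F a₀ ε₂₉ hlim hc hu,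
      recordPlimMomentDominatedOnBoxAx_of_pvol F a₀ ε₂₉ hlim hdom,
      recordPlimMomentNegPartOnBoxAx_of_pvol_lowerTight F a₀ ε₂₉ hlim habs htight⟩

--§8e-BEGIN
/-! ## §8e  The two-volume letter AT THE JUNCTION: what lens-1's [E] feeds, and the box ∕ locally-uniform edition that feeds (C)

Lens-1's [E] `K0AxTwoVolumeRate.RecordPvolTwoVolExpOnRunsAx F a₀ ε₂₉ γ E₀ κ` (✓p814710; JOIN-T v2 derives it at the record from displayed rows) is typed ALONG RUNS
(`RGEqH n β gs → Step.InInterval γ n gs → … (prefixOf gs k)`) with its threshold `∃ K₀` chosen AFTER `(gs, k, μ, ν, z)`.  TYPED EDGE FACTS: (e1) it feeds (L-lim) ALONG RUNS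
by name (`K0AxTwoVolumeRate.recordPolLimitOnRunsAx_of_twoVolExp`) and so K0ᴬ's RUN doors; (e2) it does not reach the junction body `CofinalBetaSocketAxBody` (§5): its |β| half
is `BetaLowerH ∕ BetaUpperH` on the BOX `]0, γ₀]^{k+1}` — ALL histories, of which the `]0, γ₀]`-runs are the one-parameter family `x ↦ run(x)` ((0.20) determines a run from
`gs 0`) — and every box door (✓p816129 `recordPlimAbsMomentOnBoxAx_of_pvol`, §6–§8) consumes `PolLimitOnBoxOf`; (e3) for the continuity row (C) a threshold chosen after the
history gives pointwise convergence only, while (V-lucauchy-box) wants `K₀` uniform on a relative box-neighbourhood; (e4) no two-volume DIFFERENCE letter feeds |β| (absolute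
size: (V-absmom-box)) or (iv) (sign: (V-lowtight-box)).  Hence the weakest [E]-shaped letter serving the junction's limit-side needs is [E] with exactly TWO quantifier edits —
histories over the box, and `∃ K₀` in front of `∀ w ∈ t` — typed next, with its two consequences and the door it opens. -/

/-- (E-lu-box E₀ κ): **the two-volume exp-in-period letter ON THE BOX with a LOCALLY history-uniform threshold** — lens-1's [E]
(`K0AxTwoVolumeRate.RecordPvolTwoVolExpOnRunsAx`) with `prefixOf gs k` ↦ any box history `v ∈ ]0, γ]^{k+1}` and `∃ K₀` moved in front of a relative box-neighbourhood `t ∋ v`;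
same constants `E₀, κ`, same majorant `E₀·exp(−κ·(F.P K).sitesPerDir (k+1))` (below the wrapping scale the localized expansions of two volumes agree; their constants are
history-free in print, p. 263 «absolute constants»).  A displayed hypothesis SHAPE, inhabited nowhere; S-wrap EXEMPT (two-volume differences).
[cite: Balaban1987RG1, (1.21) p.264, (1.7) p.261, (1.18) p.263, p.263, Thm 3 p.264; Balaban1988RG2, (1.33)–(1.36)] -/
def RecordPvolTwoVolExpLocUnifOnBoxAx (γ E₀ κ : ℝ) : Prop :=
  0 < κ ∧ ∀ (k : ℕ) (μ ν : Fin 4) (z : Fin 4 → ℤ) (v : Fin (k + 1) → ℝ), v ∈ Box γ k → ∃ t ∈ 𝓝[Box γ k] v, ∃ K₀ : ℕ, ∀ K : ℕ, K₀ ≤ K →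
    ∀ w ∈ t, |recordPvolAx F a₀ ε₂₉ k w (K + 1) μ ν z - recordPvolAx F a₀ ε₂₉ k w K μ ν z|
      ≤ E₀ * Real.exp (-(κ * (((F.P K).sitesPerDir (k + 1) : ℕ) : ℝ)))

/-- **Uniformly Cauchy on a set from an EVENTUALLY (beyond `K₀`) uniform geometric bound on consecutive differences, any-sign constant** — the thresholded corollary of
the tree's `Literature.Analysis.Calculus.uniformCauchySeqOn_of_le_geometric` (applied to the `K₀`-shifted sequence with constant `max C 0 · r^{K₀}`, then un-shifted through
`Metric.uniformCauchySeqOn_iff`). [cite: Balaban1987RG1, (1.21) p.264 (bookkeeping: volume-Cauchy uniformly in the couplings)] -/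
theorem uniformCauchySeqOn_of_eventually_le_geometric {X : Type*} {a : ℕ → X → ℝ} {t : Set X} {C r : ℝ} {K₀ : ℕ} (hr₀ : 0 ≤ r) (hr : r < 1)
    (h : ∀ K : ℕ, K₀ ≤ K → ∀ w ∈ t, |a (K + 1) w - a K w| ≤ C * r ^ K) : UniformCauchySeqOn a atTop t := by
  have hs : UniformCauchySeqOn (fun n => a (n + K₀)) atTop t :=
    Literature.Analysis.Calculus.uniformCauchySeqOn_of_le_geometric (a := max C 0 * r ^ K₀) (r := r)
      (mul_nonneg (le_max_right _ _) (pow_nonneg hr₀ _)) hr₀ hr fun n w hw => by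
        rw [Real.norm_eq_abs, Nat.add_right_comm, mul_assoc, ← pow_add, add_comm K₀ n]
        exact (h (n + K₀) (Nat.le_add_left K₀ n) w hw).trans (mul_le_mul_of_nonneg_right (le_max_left _ _) (pow_nonneg hr₀ _))
  refine Metric.uniformCauchySeqOn_iff.2 fun ε hε => ?_
  obtain ⟨N, hN⟩ := Metric.uniformCauchySeqOn_iff.1 hs ε hε
  refine ⟨N + K₀, fun m hm n hn w hw => ?_⟩
  have := hN (m - K₀) (by omega) (n - K₀) (by omega) w hw
  simpa [Nat.sub_add_cancel (show K₀ ≤ m by omega), Nat.sub_add_cancel (show K₀ ≤ n by omega)] using this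

/-- ★ **(E-lu-box) ⟹ (V-lucauchy-box)**: the locally history-uniform two-volume letter makes the finite-volume `(0,1)` entries uniformly Cauchy in the volume on the
neighbourhood it names (explicit constants `|E₀|`, `e^{−κ}` beyond `max K₀ (2k+2)`, as in lens-1's `geomRow_of_expScale`). [cite: Balaban1987RG1, (1.21) p.264, (1.7) p.261, Thm 3 p.264] -/
theorem recordPvolLocUniformCauchyOnBoxAx_of_twoVolExpLocUnif {γ E₀ κ : ℝ} (h : RecordPvolTwoVolExpLocUnifOnBoxAx F a₀ ε₂₉ γ E₀ κ) :
    RecordPvolLocUniformCauchyOnBoxAx F a₀ ε₂₉ γ := by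
  intro k z v hv
  obtain ⟨t, ht, K₀, hK⟩ := h.2 k 0 1 z v hv
  refine ⟨t, ht, uniformCauchySeqOn_of_eventually_le_geometric (C := |E₀|) (r := Real.exp (-κ)) (K₀ := max K₀ (2 * k + 2)) (Real.exp_nonneg _)
    (Real.exp_lt_one_iff.2 (neg_lt_zero.2 h.1)) fun K hK' w hw => ?_⟩
  have hpow : Real.exp (-κ) ^ K = Real.exp (-(κ * K)) := by rw [← Real.exp_nat_mul]; ring_nf
  calc |recordPvolAx F a₀ ε₂₉ k w (K + 1) 0 1 z - recordPvolAx F a₀ ε₂₉ k w K 0 1 z|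
      ≤ E₀ * Real.exp (-(κ * (((F.P K).sitesPerDir (k + 1) : ℕ) : ℝ))) := hK K ((le_max_left _ _).trans hK') w hw
    _ ≤ |E₀| * Real.exp (-(κ * (((F.P K).sitesPerDir (k + 1) : ℕ) : ℝ))) := mul_le_mul_of_nonneg_right (le_abs_self _) (Real.exp_nonneg _)
    _ ≤ |E₀| * Real.exp (-(κ * K)) := by
        refine mul_le_mul_of_nonneg_left (Real.exp_le_exp.2 ?_) (abs_nonneg _)
        have := mul_le_mul_of_nonneg_left (K0AxTwoVolumeRate.natCast_le_sitesPerDir F k K ((le_max_right _ _).trans hK')) h.1.le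
        linarith
    _ = |E₀| * Real.exp (-κ) ^ K := by rw [hpow]

/-- ★ **(E-lu-box) ⟹ (L-lim-box)** (the volume limit exists at every box history: `w := v` and lens-1's pointwise engine `K0AxJoinResidual.polLimitExists_of_twoVolume_geomRate`).
[cite: Balaban1987RG1, (1.21) p.264, (1.7) p.261] -/
theorem polLimitOnBoxOf_of_twoVolExpLocUnif {γ E₀ κ : ℝ} (h : RecordPvolTwoVolExpLocUnifOnBoxAx F a₀ ε₂₉ γ E₀ κ) :
    letI θ := thetaFill F a₀ ε₂₉
    letI := θ.instVβ₁; letI := θ.instVβ₂; letI := θ.instιβ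
    PolLimitOnBoxOf F (recordTermsAx F a₀ ε₂₉) θ.ρ8 θ.bV γ := by
  intro k v hv
  letI θ := thetaFill F a₀ ε₂₉
  letI := θ.instVβ₁; letI := θ.instVβ₂; letI := θ.instιβ
  refine K0AxJoinResidual.polLimitExists_of_twoVolume_geomRate F (k + 1) (fun K => recordTermsAx F a₀ ε₂₉ k v K) θ.ρ8 θ.bV fun μ ν z => ?_
  obtain ⟨t, ht, K₀, hK⟩ := h.2 k μ ν z v hv
  exact K0AxTwoVolumeRate.geomRow_of_expScale h.1 (K0AxTwoVolumeRate.natCast_le_sitesPerDir F k) fun K hK' => hK K hK' v (mem_of_mem_nhdsWithin hv ht)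

/-- ★★★ **K0ᴬ BY NAME with lens-1's letter in its junction-grade edition**: (E-lu-box) + (V-absmom-box) + (V-dom-ev-box) + (V-cont-box) + (V-lowtight-box e) at cofinally small
radii ⟹ `Theses.BalabanUVNodes.Record13SepCoPHInhabitedAx` — §8d's door with (L-lim-box) ∧ (V-lucauchy-box) both read off (E-lu-box).  What the two-volume letter does NOT pay
stays displayed: the absolute moments (|β|), the pointwise-eventual domination and finite-volume continuity ((C)), the one-sided tightness ((iv), the AF sign).  CONDITIONAL on the
displayed supply — OPEN Bałaban-strength content; K0ᴬ stmt-QuantumFields-27238 OPEN; the Yang–Mills mass gap is NOT proved.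
[cite: Balaban1987RG1, Thm 1 p.259, Thm 2 (0.31) p.259, Thm 3 p.264, (1.7) p.261, (1.20)–(1.22) p.264, (4.37) p.291, (5.42)–(5.44) p.297; Balaban1988RG2, (1.33)–(1.36)] -/
theorem record13SepCoPHInhabitedAx_of_twoVolExpBoxLettersTight_cofinalRadii
    (H : ∀ (F : T4Family) (a : ℝ), 0 < a → ∃ a₀ : ℝ, 0 < a₀ ∧ a₀ ≤ a ∧ ∃ (γ₀ ε₂₉ E₀ κ M : ℝ) (e : ℕ → ℝ), 0 < γ₀ ∧ γ₀ ≤ 1 / 2 ∧ 0 < ε₂₉ ∧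
      RecordPvolTwoVolExpLocUnifOnBoxAx F a₀ ε₂₉ γ₀ E₀ κ ∧
      RecordPvolAbsMomentOnBoxAx F a₀ ε₂₉ γ₀ M ∧ RecordPvolMomentDominatedEvOnBoxAx F a₀ ε₂₉ γ₀ ∧ RecordPvolContOnBoxAx F a₀ ε₂₉ γ₀ ∧
        RecordPvolMomentLowerTightOnBoxAx F a₀ ε₂₉ γ₀ e) :
    Summit.QuantumFields.YangMills.Theses.BalabanUVNodes.Record13SepCoPHInhabitedAx :=
  record13SepCoPHInhabitedAx_of_pvolBoxLettersTight_cofinalRadii fun F a ha => by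
    obtain ⟨a₀, ha₀, hle, γ₀, ε₂₉, E₀, κ, M, e, hγ₀, hγh, hε, hE, hV, hdom, hc, htight⟩ := H F a ha
    exact ⟨a₀, ha₀, hle, γ₀, ε₂₉, M, e, hγ₀, hγh, hε, polLimitOnBoxOf_of_twoVolExpLocUnif F a₀ ε₂₉ hE, hV, hdom, hc,
      recordPvolLocUniformCauchyOnBoxAx_of_twoVolExpLocUnif F a₀ ε₂₉ hE, htight⟩
--§8e-END

-- AXIOM CENSUS of the tight ∕ local door and of its two-volume edition: standard axioms only (no `sorryAx`).
#print axioms record13SepCoPHInhabitedAx_of_pvolBoxLettersTight_cofinalRadii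
#print axioms record13SepCoPHInhabitedAx_of_twoVolExpBoxLettersTight_cofinalRadii

end Summit.QuantumFields.YangMills.Theorems.K0AxMomentRoad
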